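import Mathlib.LinearAlgebra.Trace
import Mathlib.LinearAlgebra.Matrix.ToLin
import Mathlib.LinearAlgebra.FiniteDimensional.Lemmas
import Mathlib.Tactic.NoncommRing
import HarnessLib

/-!
# An irreducible Lie algebra of endomorphisms of a `3`-space stable under `ad` of a rank-two idempotent contains `𝔰𝔩₃`

Topic `Literature/Algebra/Lie` (namespace `Literature.Algebra.Lie`); companion of `IrreducibleLinearLieAlgebraPlane`
(the `dim 2` case). VOCABULARY-FREE linear algebra (cell `pub-hodgeav-hg6`, req-37 (A) Q2b, TABLE X row 10, brick (a)
of the eng-5 g6 plan «the derived Hodge Lie algebra of a CM field `E` with `dim_E H¹ = 3` projects onto `𝔰𝔩(W_σ)` at a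
mixed place»): THEOREMS ONLY, no definition, no instance, no named fact.

THE THEOREM (`mem_of_trace_eq_zero_of_irreducible_three`). Let `dim_K M = 3` with basis `b = (b₀, b₁, b₂)`, `e` the
endomorphism with `e b₀ = 0`, `e b₁ = b₁`, `e b₂ = b₂` (a rank-two idempotent), and `𝔊 ⊆ End(M)` a subspace closed under
`YZ − ZY`, stable under `X ↦ eX − Xe`, and irreducible (no `𝔊`-stable subspace other than `0`, `M`). Then every traceless
endomorphism of `M` lies in `𝔊` (`char K = 0`). In the application `e = (1 + Θ)/2` for the Hodge operator `Θ = ±1` of a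
`3`-dimensional eigenspace `W_σ` of signature `(2,1)`, and `Θ ∈ 𝔊`.

PROOF (elementary, no classification of subalgebras of `𝔰𝔩₃`). §1 `ad(e)` has eigenvalues `0, ±1` on `End(M)` with
eigen-components `X₀₀ = eXe + (1−e)X(1−e)`, `X₊ = eX(1−e)`, `X₋ = (1−e)Xe`; stability under `ad(e)` puts all three
components of every `X ∈ 𝔊` in `𝔊` (`X₊ ± X₋ = ad(e)²X ± ad(e)X`). §2 In the coordinates `E_{ij} = b_i ⊗ b_j^*`:
`X₊ ∈ E₊ = ⟨E₁₀, E₂₀⟩`, `X₋ ∈ E₋ = ⟨E₀₁, E₀₂⟩`. Irreducibility gives some `X₊ ≠ 0` (else `K b₀` is stable) and some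
`X₋ ≠ 0` (else `⟨b₁, b₂⟩` is stable). §3 If `E₊ ⊄ 𝔊` then `𝔊 ∩ E₊ = K x₀` and `K b₀ + x₀(M)` (dimension `≤ 2`) is
`𝔊`-stable — contradiction; so `E₊ ⊆ 𝔊`, and symmetrically `E₋ ⊆ 𝔊` (else `𝔊 ∩ E₋ = K y₀` and the line
`⟨b₁, b₂⟩ ∩ ker y₀` is stable). §4 `[E_{i0}, E_{0j}] = E_{ij} − δ_{ij} E₀₀` then yields every traceless block-diagonal
element, hence all of `𝔰𝔩(M)`.

## References (the statement is the `𝔰𝔩₃`-analogue of the plane lemma used for Moonen–Zarhin's unitary Hodge groups)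
* [Humphreys1972] J. E. Humphreys, Introduction to Lie Algebras and Representation Theory, GTM 9, §1.2 (`A_ℓ`,
  `dim 𝔰𝔩(ℓ+1) = (ℓ+1)² − 1`, the basis `e_{ij}`), §8.1 (root space decomposition relative to `ad h`).
* [MoonenZarhin1999LowDim] B. Moonen, Yu. Zarhin, Math. Ann. 315 (1999), §2 (2.3) (`Hg = U_E`: the Lie algebra acts on
  each `W_σ` through `𝔤𝔩(W_σ)`), the consumer.
-/

namespace Literature.Algebra.Lie

open Module

/-! ## §1 Idempotent bookkeeping in a ring -/

section RingIdentities

variable {R : Type*} [Ring R]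

/-- `e(1 − e) = 0` for an idempotent. [folklore] -/
private theorem idem_mul_one_sub {e : R} (he : e * e = e) : e * (1 - e) = 0 := by
  rw [mul_sub, mul_one, he, sub_self]

/-- `(1 − e)e = 0` for an idempotent. [folklore] -/
private theorem one_sub_mul_idem {e : R} (he : e * e = e) : (1 - e) * e = 0 := by
  rw [sub_mul, one_mul, he, sub_self]

/-- `X = eXe + eX(1−e) + (1−e)Xe + (1−e)X(1−e)`. [folklore] -/
private theorem decomp_idem (e X : R) :
    X = (e * X * e + (1 - e) * X * (1 - e)) + e * X * (1 - e) + (1 - e) * X * e := by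
  noncomm_ring

/-- `ad(e) X = X₊ − X₋`. [folklore] -/
private theorem ad_eq_plus_sub_minus (e X : R) : e * X - X * e = e * X * (1 - e) - (1 - e) * X * e := by
  noncomm_ring

/-- `ad(e) X₊ = X₊`. [folklore] -/
private theorem ad_plus {e : R} (he : e * e = e) (X : R) :
    e * (e * X * (1 - e)) - e * X * (1 - e) * e = e * X * (1 - e) := by
  rw [show e * (e * X * (1 - e)) = (e * e) * X * (1 - e) by noncomm_ring, he,
    show e * X * (1 - e) * e = e * X * ((1 - e) * e) by noncomm_ring, one_sub_mul_idem he, mul_zero, sub_zero]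

/-- `ad(e) X₋ = −X₋`. [folklore] -/
private theorem ad_minus {e : R} (he : e * e = e) (X : R) :
    e * ((1 - e) * X * e) - (1 - e) * X * e * e = -((1 - e) * X * e) := by
  rw [show e * ((1 - e) * X * e) = (e * (1 - e)) * X * e by noncomm_ring, idem_mul_one_sub he, zero_mul, zero_mul,
    zero_sub, show (1 - e) * X * e * e = (1 - e) * X * (e * e) by noncomm_ring, he]

/-- `e X₀₀ = eXe`. [folklore] -/
private theorem idem_mul_diag {e : R} (he : e * e = e) (X : R) :
    e * (e * X * e + (1 - e) * X * (1 - e)) = e * X * e := by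
  rw [mul_add, show e * (e * X * e) = (e * e) * X * e by noncomm_ring, he,
    show e * ((1 - e) * X * (1 - e)) = (e * (1 - e)) * X * (1 - e) by noncomm_ring, idem_mul_one_sub he, zero_mul,
    zero_mul, add_zero]

/-- `X₀₀ e = eXe`. [folklore] -/
private theorem diag_mul_idem {e : R} (he : e * e = e) (X : R) :
    (e * X * e + (1 - e) * X * (1 - e)) * e = e * X * e := by
  rw [add_mul, show e * X * e * e = e * X * (e * e) by noncomm_ring, he,
    show (1 - e) * X * (1 - e) * e = (1 - e) * X * ((1 - e) * e) by noncomm_ring, one_sub_mul_idem he, mul_zero, add_zero]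

/-- `X₀₀ x = eXe x` when `e x = x`. [folklore] -/
private theorem diag_mul_of_idem_mul_eq {e x : R} (hx : e * x = x) (X : R) :
    (e * X * e + (1 - e) * X * (1 - e)) * x = e * X * e * x := by
  rw [add_mul, show (1 - e) * X * (1 - e) * x = (1 - e) * X * (x - e * x) by noncomm_ring, hx, sub_self, mul_zero,
    add_zero]

/-- `X₀₀ y = X₀₀... `: `y X₀₀ = y e X e` when `y e = y`. [folklore] -/
private theorem mul_diag_of_mul_idem_eq {e y : R} (hy : y * e = y) (X : R) :
    y * (e * X * e + (1 - e) * X * (1 - e)) = y * X * e := by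
  rw [mul_add, show y * (e * X * e) = (y * e) * X * e by noncomm_ring, hy,
    show y * ((1 - e) * X * (1 - e)) = (y - y * e) * X * (1 - e) by noncomm_ring, hy, sub_self, zero_mul, zero_mul,
    add_zero]

end RingIdentities

/-! ## §2 The `ad(e)`-components of an `ad(e)`-stable subspace -/

section Components

variable {K : Type*} [Field K] [CharZero K] {M : Type*} [AddCommGroup M] [Module K M]

/-- **The three `ad(e)`-components of `X ∈ 𝔊` lie in `𝔊`** when `𝔊` is stable under `X ↦ eX − Xe` (`e` idempotent,
`char K ≠ 2`): `X₊ = eX(1−e)`, `X₋ = (1−e)Xe` and `X₀₀ = eXe + (1−e)X(1−e)`. [cite: Humphreys1972, §8.1] -/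
theorem components_mem_of_ad_stable (𝔊 : Submodule K (Module.End K M)) {e : Module.End K M} (he : e * e = e)
    (had : ∀ X ∈ 𝔊, e * X - X * e ∈ 𝔊) {X : Module.End K M} (hX : X ∈ 𝔊) :
    e * X * (1 - e) ∈ 𝔊 ∧ (1 - e) * X * e ∈ 𝔊 ∧ e * X * e + (1 - e) * X * (1 - e) ∈ 𝔊 := by
  have h1 : e * X * (1 - e) - (1 - e) * X * e ∈ 𝔊 := ad_eq_plus_sub_minus e X ▸ had X hX
  have h2 : e * X * (1 - e) + (1 - e) * X * e ∈ 𝔊 := by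
    have h := had _ h1
    rwa [mul_sub e (e * X * (1 - e)) ((1 - e) * X * e), sub_mul (e * X * (1 - e)) ((1 - e) * X * e) e,
      sub_sub_sub_comm, ad_plus he, ad_minus he, sub_neg_eq_add] at h
  have hp : e * X * (1 - e) ∈ 𝔊 := by
    have h : e * X * (1 - e) = (2 : K)⁻¹ • ((e * X * (1 - e) - (1 - e) * X * e) + (e * X * (1 - e) + (1 - e) * X * e)) := by
      rw [sub_add_add_cancel, ← two_smul K, smul_smul, inv_mul_cancel₀ two_ne_zero, one_smul]
    rw [h]
    exact 𝔊.smul_mem _ (𝔊.add_mem h1 h2)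
  have hm : (1 - e) * X * e ∈ 𝔊 := by
    have h : (1 - e) * X * e = (e * X * (1 - e) + (1 - e) * X * e) - e * X * (1 - e) := by rw [add_sub_cancel_left]
    rw [h]
    exact 𝔊.sub_mem h2 hp
  refine ⟨hp, hm, ?_⟩
  have h : e * X * e + (1 - e) * X * (1 - e) = X - e * X * (1 - e) - (1 - e) * X * e := by
    calc e * X * e + (1 - e) * X * (1 - e)
        = ((e * X * e + (1 - e) * X * (1 - e)) + e * X * (1 - e) + (1 - e) * X * e) - e * X * (1 - e) -
            (1 - e) * X * e := by abel
      _ = X - e * X * (1 - e) - (1 - e) * X * e := by rw [← decomp_idem e X]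
  rw [h]
  exact 𝔊.sub_mem (𝔊.sub_mem hX hp) hm

end Components

/-! ## §3 Coordinates: the matrix units of a basis of a `3`-space adapted to the idempotent -/

section Three

variable {K : Type*} [Field K] {M : Type*} [AddCommGroup M] [Module K M]

/-- `E_{ij} b_j = b_i`. [folklore] -/
private theorem unit_apply_self (b : Basis (Fin 3) K M) (i j : Fin 3) :
    ((b.coord j).smulRight (b i)) (b j) = b i := by
  rw [LinearMap.smulRight_apply, Basis.coord_apply, Basis.repr_self, Finsupp.single_eq_same, one_smul]

/-- `E_{ij} b_k = 0` for `k ≠ j`. [folklore] -/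
private theorem unit_apply_ne (b : Basis (Fin 3) K M) (i : Fin 3) {j k : Fin 3} (hjk : j ≠ k) :
    ((b.coord j).smulRight (b i)) (b k) = 0 := by
  rw [LinearMap.smulRight_apply, Basis.coord_apply, Basis.repr_self, Finsupp.single_eq_of_ne hjk, zero_smul]

/-- `E_{ij} E_{jl} = E_{il}`. [folklore] -/
private theorem unit_mul_unit_self (b : Basis (Fin 3) K M) (i j l : Fin 3) :
    (b.coord j).smulRight (b i) * (b.coord l).smulRight (b j) = (b.coord l).smulRight (b i) := by
  refine b.ext fun k => ?_
  rw [Module.End.mul_apply]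
  by_cases hlk : l = k
  · subst hlk
    rw [unit_apply_self, unit_apply_self, unit_apply_self]
  · rw [unit_apply_ne b j hlk, unit_apply_ne b i hlk, map_zero]

/-- `E_{ij} E_{kl} = 0` for `j ≠ k`. [folklore] -/
private theorem unit_mul_unit_ne (b : Basis (Fin 3) K M) (i : Fin 3) {j k : Fin 3} (hjk : j ≠ k) (l : Fin 3) :
    (b.coord j).smulRight (b i) * (b.coord l).smulRight (b k) = 0 := by
  refine b.ext fun m => ?_
  rw [Module.End.mul_apply, LinearMap.zero_apply]
  by_cases hlm : l = m
  · subst hlm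
    rw [unit_apply_self, unit_apply_ne b i hjk]
  · rw [unit_apply_ne b k hlm, map_zero]

/-- **Expansion in matrix units**: `Z = Σ_{ij} (b^* _i (Z b_j)) E_{ij}`. [cite: Humphreys1972, §1.2] -/
theorem eq_sum_units (b : Basis (Fin 3) K M) (Z : Module.End K M) :
    Z = ∑ i, ∑ j, b.repr (Z (b j)) i • (b.coord j).smulRight (b i) := by
  refine b.ext fun k => ?_
  rw [LinearMap.sum_apply]
  simp_rw [LinearMap.sum_apply, LinearMap.smul_apply]
  rw [Finset.sum_comm]
  rw [Finset.sum_eq_single k (fun j _ hjk => by simp_rw [unit_apply_ne b _ hjk, smul_zero, Finset.sum_const_zero])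
    (fun h => absurd (Finset.mem_univ k) h)]
  simp_rw [unit_apply_self]
  exact (b.sum_repr (Z (b k))).symm

/-- **`tr Z = Σ_i b^*_i (Z b_i)`**. [cite: Humphreys1972, §1.2] -/
theorem trace_eq_sum_repr (b : Basis (Fin 3) K M) (Z : Module.End K M) :
    LinearMap.trace K M Z = ∑ i, b.repr (Z (b i)) i := by
  rw [LinearMap.trace_eq_matrix_trace K b Z, Matrix.trace]
  simp_rw [Matrix.diag_apply, LinearMap.toMatrix_apply]

/-- The hypotheses package: `e b₀ = 0`, `e b₁ = b₁`, `e b₂ = b₂` gives `e = E₁₁ + E₂₂` and `e² = e`. [folklore] -/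
private theorem idem_eq_units (b : Basis (Fin 3) K M) {e : Module.End K M} (he0 : e (b 0) = 0) (he1 : e (b 1) = b 1)
    (he2 : e (b 2) = b 2) : e = (b.coord 1).smulRight (b 1) + (b.coord 2).smulRight (b 2) := by
  refine b.ext fun k => ?_
  rcases k with ⟨_ | _ | _ | n, hk⟩
  · show e (b 0) = ((b.coord 1).smulRight (b 1)) (b 0) + ((b.coord 2).smulRight (b 2)) (b 0)
    rw [he0, unit_apply_ne b 1 (by decide), unit_apply_ne b 2 (by decide), add_zero]
  · show e (b 1) = ((b.coord 1).smulRight (b 1)) (b 1) + ((b.coord 2).smulRight (b 2)) (b 1)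
    rw [he1, unit_apply_self, unit_apply_ne b 2 (by decide), add_zero]
  · show e (b 2) = ((b.coord 1).smulRight (b 1)) (b 2) + ((b.coord 2).smulRight (b 2)) (b 2)
    rw [he2, unit_apply_ne b 1 (by decide), unit_apply_self, zero_add]
  · omega

/-- `e m = (b^*_1 m) b₁ + (b^*_2 m) b₂` and `m − e m = (b^*_0 m) b₀`. [folklore] -/
private theorem idem_apply (b : Basis (Fin 3) K M) {e : Module.End K M} (he0 : e (b 0) = 0) (he1 : e (b 1) = b 1)
    (he2 : e (b 2) = b 2) (m : M) :
    e m = b.repr m 1 • b 1 + b.repr m 2 • b 2 ∧ m - e m = b.repr m 0 • b 0 := by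
  have hm : m = b.repr m 0 • b 0 + b.repr m 1 • b 1 + b.repr m 2 • b 2 := by
    conv_lhs => rw [← b.sum_repr m]
    rw [Fin.sum_univ_three]
  have h1 : e m = b.repr m 1 • b 1 + b.repr m 2 • b 2 := by
    conv_lhs => rw [hm]
    rw [map_add, map_add, map_smul, map_smul, map_smul, he0, he1, he2, smul_zero, zero_add]
  refine ⟨h1, ?_⟩
  have h2 : m - e m = (b.repr m 0 • b 0 + b.repr m 1 • b 1 + b.repr m 2 • b 2) - (b.repr m 1 • b 1 + b.repr m 2 • b 2) := by
    rw [← h1, ← hm]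
  rw [h2]
  abel

/-! ## §4 The theorem -/

variable [CharZero K] [FiniteDimensional K M]

omit [CharZero K] [FiniteDimensional K M] in
/-- `dim (K ∙ y) ≤ 1`. [folklore] -/
private theorem finrank_span_singleton_le_one (y : M) : finrank K (K ∙ y) ≤ 1 :=
  (finrank_span_le_card ({y} : Set M)).trans (by simp)

/-- **AN IRREDUCIBLE `ad(e)`-STABLE LIE ALGEBRA OF ENDOMORPHISMS OF A `3`-SPACE CONTAINS `𝔰𝔩₃`** (`e` the idempotent
with `e b₀ = 0`, `e b₁ = b₁`, `e b₂ = b₂` for a basis `b`; `char K = 0`): if `𝔊 ⊆ End(M)` is a subspace closed under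
`YZ − ZY` and under `X ↦ eX − Xe` admitting no `𝔊`-stable subspace other than `0` and `M`, then every traceless
endomorphism of `M` lies in `𝔊`. See the module docstring for the (classification-free) proof.
[cite: Humphreys1972, §1.2 and §8.1] [cite: MoonenZarhin1999LowDim, §2 (2.3)] -/
theorem mem_of_trace_eq_zero_of_irreducible_three (b : Basis (Fin 3) K M)
    (𝔊 : Submodule K (Module.End K M)) (hbr : ∀ Y ∈ 𝔊, ∀ Z ∈ 𝔊, Y * Z - Z * Y ∈ 𝔊)
    (hirr : ∀ U : Submodule K M, (∀ Z ∈ 𝔊, ∀ u ∈ U, Z u ∈ U) → U = ⊥ ∨ U = ⊤)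
    {e : Module.End K M} (he0 : e (b 0) = 0) (he1 : e (b 1) = b 1) (he2 : e (b 2) = b 2)
    (had : ∀ X ∈ 𝔊, e * X - X * e ∈ 𝔊) {Y : Module.End K M} (hY : LinearMap.trace K M Y = 0) : Y ∈ 𝔊 := by
  classical
  have hM3 : finrank K M = 3 := by rw [finrank_eq_card_basis b, Fintype.card_fin]
  have h01 : (0 : Fin 3) ≠ 1 := by decide
  have h02 : (0 : Fin 3) ≠ 2 := by decide
  have h10 : (1 : Fin 3) ≠ 0 := by decide
  have h12 : (1 : Fin 3) ≠ 2 := by decide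
  have h20 : (2 : Fin 3) ≠ 0 := by decide
  have h21 : (2 : Fin 3) ≠ 1 := by decide
  -- `e² = e`
  have he : e * e = e := by
    rw [idem_eq_units b he0 he1 he2, add_mul, mul_add, mul_add, unit_mul_unit_self, unit_mul_unit_ne b 1 h12,
      unit_mul_unit_ne b 2 h21, unit_mul_unit_self, add_zero, zero_add]
  -- how the three components act
  have happ_plus : ∀ (X : Module.End K M) (v : M), (e * X * (1 - e)) v = e (X (v - e v)) := fun X v => by
    rw [Module.End.mul_apply, Module.End.mul_apply, LinearMap.sub_apply, Module.End.one_apply]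
  have happ_minus : ∀ (X : Module.End K M) (v : M), ((1 - e) * X * e) v = X (e v) - e (X (e v)) := fun X v => by
    rw [Module.End.mul_apply, Module.End.mul_apply, LinearMap.sub_apply, Module.End.one_apply]
  have happ_diag : ∀ (X : Module.End K M) (v : M),
      (e * X * e + (1 - e) * X * (1 - e)) v = e (X (e v)) + (X (v - e v) - e (X (v - e v))) := fun X v => by
    rw [LinearMap.add_apply, Module.End.mul_apply, Module.End.mul_apply, Module.End.mul_apply, Module.End.mul_apply,
      LinearMap.sub_apply, Module.End.one_apply, LinearMap.sub_apply, Module.End.one_apply]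
  have hsub : ∀ v : M, v - e v = b.repr v 0 • b 0 := fun v => (idem_apply b he0 he1 he2 v).2
  have heapp : ∀ v : M, e v = b.repr v 1 • b 1 + b.repr v 2 • b 2 := fun v => (idem_apply b he0 he1 he2 v).1
  -- the span of `b₁, b₂` (the image of `e`) and the kernel line `K b₀`
  have hPfix : ∀ u ∈ Submodule.span K ({b 1, b 2} : Set M), e u = u := by
    intro u hu
    obtain ⟨c, d, rfl⟩ := Submodule.mem_span_pair.1 hu
    rw [map_add, map_smul, map_smul, he1, he2]
  have hPmem : ∀ v : M, e v ∈ Submodule.span K ({b 1, b 2} : Set M) := fun v => by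
    rw [heapp]
    exact Submodule.add_mem _ (Submodule.smul_mem _ _ (Submodule.subset_span (by simp)))
      (Submodule.smul_mem _ _ (Submodule.subset_span (by simp)))
  have hP2 : finrank K (Submodule.span K ({b 1, b 2} : Set M)) ≤ 2 := by
    rw [Submodule.span_insert]
    exact (Submodule.finrank_add_le_finrank_add_finrank _ _).trans
      (add_le_add (finrank_span_singleton_le_one _) (finrank_span_singleton_le_one _))
  have hQmem : ∀ v : M, e v = 0 → v ∈ K ∙ b 0 := fun v hv => by
    have h := hsub v
    rw [hv, sub_zero] at h
    rw [h]
    exact Submodule.smul_mem _ _ (Submodule.mem_span_singleton_self _)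
  -- the `±`-components in coordinates
  have plus_eq : ∀ X : Module.End K M, e * X * (1 - e) =
      b.repr (X (b 0)) 1 • (b.coord 0).smulRight (b 1) + b.repr (X (b 0)) 2 • (b.coord 0).smulRight (b 2) := by
    intro X
    refine LinearMap.ext fun v => ?_
    rw [happ_plus, hsub, map_smul, map_smul, heapp (X (b 0))]
    simp only [LinearMap.add_apply, LinearMap.smul_apply, LinearMap.smulRight_apply, Basis.coord_apply]
    module
  have minus_eq : ∀ X : Module.End K M, (1 - e) * X * e =
      b.repr (X (b 1)) 0 • (b.coord 1).smulRight (b 0) + b.repr (X (b 2)) 0 • (b.coord 2).smulRight (b 0) := by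
    intro X
    refine LinearMap.ext fun v => ?_
    rw [happ_minus, hsub, heapp v]
    simp only [map_add, map_smul, Finsupp.add_apply, Finsupp.smul_apply, LinearMap.add_apply, LinearMap.smul_apply,
      LinearMap.smulRight_apply, Basis.coord_apply, smul_eq_mul]
    module
  -- membership criteria for `E₊ = ⟨E₁₀, E₂₀⟩`, `E₋ = ⟨E₀₁, E₀₂⟩`
  have mem_Ep : ∀ B : Module.End K M, e * B = B → B * e = 0 →
      B ∈ Submodule.span K ({(b.coord 0).smulRight (b 1), (b.coord 0).smulRight (b 2)} : Set (Module.End K M)) := by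
    intro B h1 h2
    have hB : B = e * B * (1 - e) := by rw [h1, mul_sub, mul_one, h2, sub_zero]
    rw [hB, plus_eq]
    exact Submodule.add_mem _ (Submodule.smul_mem _ _ (Submodule.subset_span (by simp)))
      (Submodule.smul_mem _ _ (Submodule.subset_span (by simp)))
  have mem_Em : ∀ B : Module.End K M, e * B = 0 → B * e = B →
      B ∈ Submodule.span K ({(b.coord 1).smulRight (b 0), (b.coord 2).smulRight (b 0)} : Set (Module.End K M)) := by
    intro B h1 h2
    have hB : B = (1 - e) * B * e := by rw [sub_mul, one_mul, h1, sub_zero, h2]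
    rw [hB, minus_eq]
    exact Submodule.add_mem _ (Submodule.smul_mem _ _ (Submodule.subset_span (by simp)))
      (Submodule.smul_mem _ _ (Submodule.subset_span (by simp)))
  have hEp2 : finrank K (Submodule.span K ({(b.coord 0).smulRight (b 1), (b.coord 0).smulRight (b 2)} :
      Set (Module.End K M))) ≤ 2 := by
    rw [Submodule.span_insert]
    exact (Submodule.finrank_add_le_finrank_add_finrank _ _).trans
      (add_le_add (finrank_span_singleton_le_one _) (finrank_span_singleton_le_one _))
  have hEm2 : finrank K (Submodule.span K ({(b.coord 1).smulRight (b 0), (b.coord 2).smulRight (b 0)} :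
      Set (Module.End K M))) ≤ 2 := by
    rw [Submodule.span_insert]
    exact (Submodule.finrank_add_le_finrank_add_finrank _ _).trans
      (add_le_add (finrank_span_singleton_le_one _) (finrank_span_singleton_le_one _))
  -- §2: non-vanishing components
  have exists_plus : ∃ X ∈ 𝔊, e * X * (1 - e) ≠ 0 := by
    by_contra! h0
    have hstab : ∀ Z ∈ 𝔊, ∀ u ∈ K ∙ b 0, Z u ∈ K ∙ b 0 := by
      intro Z hZ u hu
      obtain ⟨t, rfl⟩ := Submodule.mem_span_singleton.1 hu
      rw [map_smul]
      refine Submodule.smul_mem _ _ (hQmem _ ?_)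
      have h := LinearMap.congr_fun (h0 Z hZ) (b 0)
      rwa [happ_plus, he0, sub_zero, LinearMap.zero_apply] at h
    rcases hirr _ hstab with h | h
    · exact b.ne_zero 0 (Submodule.span_singleton_eq_bot.1 h)
    · have h1 := finrank_span_singleton (K := K) (b.ne_zero 0)
      rw [h, finrank_top, hM3] at h1
      omega
  have exists_minus : ∃ X ∈ 𝔊, (1 - e) * X * e ≠ 0 := by
    by_contra! h0
    have hstab : ∀ Z ∈ 𝔊, ∀ u ∈ Submodule.span K ({b 1, b 2} : Set M), Z u ∈ Submodule.span K ({b 1, b 2} : Set M) := by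
      intro Z hZ u hu
      have h := LinearMap.congr_fun (h0 Z hZ) u
      rw [happ_minus, LinearMap.zero_apply, sub_eq_zero, hPfix u hu] at h
      rw [h]
      exact hPmem _
    rcases hirr _ hstab with h | h
    · exact b.ne_zero 1 ((Submodule.mem_bot K).1 (h ▸ Submodule.subset_span (by simp)))
    · rw [h, finrank_top, hM3] at hP2
      omega
  -- §3: `E₊ ⊆ 𝔊`
  have Ep_le : Submodule.span K ({(b.coord 0).smulRight (b 1), (b.coord 0).smulRight (b 2)} :
      Set (Module.End K M)) ≤ 𝔊 := by
    by_contra hnot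
    obtain ⟨X₁, hX₁, hx₁⟩ := exists_plus
    obtain ⟨x₀, hx₀def⟩ : ∃ x₀ : Module.End K M, x₀ = e * X₁ * (1 - e) := ⟨_, rfl⟩
    rw [← hx₀def] at hx₁
    have hx₀𝔊 : x₀ ∈ 𝔊 := hx₀def ▸ (components_mem_of_ad_stable 𝔊 he had hX₁).1
    have hex₀ : e * x₀ = x₀ := by
      rw [hx₀def, show e * (e * X₁ * (1 - e)) = (e * e) * X₁ * (1 - e) by noncomm_ring, he]
    have hx₀e : x₀ * e = 0 := by
      rw [hx₀def, show e * X₁ * (1 - e) * e = e * X₁ * ((1 - e) * e) by noncomm_ring, one_sub_mul_idem he, mul_zero]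
    have hx₀E := mem_Ep x₀ hex₀ hx₀e
    have hlt : 𝔊 ⊓ Submodule.span K ({(b.coord 0).smulRight (b 1), (b.coord 0).smulRight (b 2)} :
        Set (Module.End K M)) < Submodule.span K ({(b.coord 0).smulRight (b 1), (b.coord 0).smulRight (b 2)} :
        Set (Module.End K M)) := lt_of_le_of_ne inf_le_right fun h => hnot (h ▸ inf_le_left)
    have hspan : 𝔊 ⊓ Submodule.span K ({(b.coord 0).smulRight (b 1), (b.coord 0).smulRight (b 2)} :
        Set (Module.End K M)) = K ∙ x₀ := by
      refine (Submodule.eq_of_le_of_finrank_le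
        ((Submodule.span_singleton_le_iff_mem _ _).2 (Submodule.mem_inf.2 ⟨hx₀𝔊, hx₀E⟩)) ?_).symm
      have h := Submodule.finrank_lt_finrank_of_lt hlt
      rw [finrank_span_singleton hx₁]
      omega
    have hmult : ∀ Z ∈ 𝔊, e * Z = Z → Z * e = 0 → ∃ t : K, t • x₀ = Z := fun Z hZ h1 h2 =>
      Submodule.mem_span_singleton.1 (hspan ▸ (Submodule.mem_inf.2 ⟨hZ, mem_Ep Z h1 h2⟩ :
        Z ∈ 𝔊 ⊓ Submodule.span K ({(b.coord 0).smulRight (b 1), (b.coord 0).smulRight (b 2)} : Set (Module.End K M))))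
    -- the stable subspace `K b₀ + x₀(M)`
    have hstab : ∀ Z ∈ 𝔊, ∀ u ∈ (K ∙ b 0) ⊔ LinearMap.range x₀, Z u ∈ (K ∙ b 0) ⊔ LinearMap.range x₀ := by
      intro Z hZ u hu
      obtain ⟨hZp, -, hZd⟩ := components_mem_of_ad_stable 𝔊 he had hZ
      obtain ⟨t, ht⟩ := hmult _ hZp
        (by rw [show e * (e * Z * (1 - e)) = (e * e) * Z * (1 - e) by noncomm_ring, he])
        (by rw [show e * Z * (1 - e) * e = e * Z * ((1 - e) * e) by noncomm_ring, one_sub_mul_idem he, mul_zero])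
      have hB1 : e * ((e * Z * e + (1 - e) * Z * (1 - e)) * x₀ - x₀ * (e * Z * e + (1 - e) * Z * (1 - e))) =
          (e * Z * e + (1 - e) * Z * (1 - e)) * x₀ - x₀ * (e * Z * e + (1 - e) * Z * (1 - e)) := by
        rw [mul_sub, ← mul_assoc e _ x₀, idem_mul_diag he Z, ← mul_assoc e x₀, hex₀, diag_mul_of_idem_mul_eq hex₀ Z]
      have hB2 : ((e * Z * e + (1 - e) * Z * (1 - e)) * x₀ - x₀ * (e * Z * e + (1 - e) * Z * (1 - e))) * e = 0 := by
        rw [sub_mul, mul_assoc _ x₀ e, hx₀e, mul_zero, zero_sub, mul_assoc x₀ _ e, diag_mul_idem he Z,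
          show x₀ * (e * Z * e) = (x₀ * e) * Z * e by noncomm_ring, hx₀e, zero_mul, zero_mul, neg_zero]
      obtain ⟨t', ht'⟩ := hmult _ (hbr _ hZd _ hx₀𝔊) hB1 hB2
      have hZu : Z u = (e * Z * e + (1 - e) * Z * (1 - e)) u + (e * Z * (1 - e)) u + ((1 - e) * Z * e) u := by
        conv_lhs => rw [decomp_idem e Z]
        rw [LinearMap.add_apply, LinearMap.add_apply]
      rw [hZu]
      refine Submodule.add_mem _ (Submodule.add_mem _ ?_ ?_) ?_
      · -- the block-diagonal part
        obtain ⟨y, hy, z, hz, rfl⟩ := Submodule.mem_sup.1 hu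
        obtain ⟨s, rfl⟩ := Submodule.mem_span_singleton.1 hy
        obtain ⟨m, rfl⟩ := LinearMap.mem_range.1 hz
        rw [map_add, map_smul]
        refine Submodule.add_mem _ (Submodule.smul_mem _ _ (Submodule.mem_sup_left (hQmem _ ?_)))
          (Submodule.mem_sup_right ?_)
        · rw [← Module.End.mul_apply, idem_mul_diag he Z, Module.End.mul_apply, Module.End.mul_apply, he0, map_zero,
            map_zero]
        · have h := LinearMap.congr_fun ht' m
          rw [LinearMap.smul_apply, LinearMap.sub_apply, Module.End.mul_apply, Module.End.mul_apply] at h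
          rw [← Module.End.mul_apply, show ((e * Z * e + (1 - e) * Z * (1 - e)) * x₀) m =
            x₀ ((e * Z * e + (1 - e) * Z * (1 - e)) m) + t' • x₀ m by rw [Module.End.mul_apply, h]; abel,
            ← map_smul, ← map_add]
          exact LinearMap.mem_range_self _ _
      · rw [← ht, LinearMap.smul_apply]
        exact Submodule.smul_mem _ _ (Submodule.mem_sup_right (LinearMap.mem_range_self _ _))
      · refine Submodule.mem_sup_left (hQmem _ ?_)
        rw [← Module.End.mul_apply, show e * ((1 - e) * Z * e) = (e * (1 - e)) * Z * e by noncomm_ring,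
          idem_mul_one_sub he, zero_mul, zero_mul, LinearMap.zero_apply]
    rcases hirr _ hstab with h | h
    · exact b.ne_zero 0 ((Submodule.mem_bot K).1 (h ▸ Submodule.mem_sup_left (Submodule.mem_span_singleton_self _)))
    · have hr : finrank K (LinearMap.range x₀) ≤ 1 := by
        have hle : LinearMap.range x₀ ≤ K ∙ x₀ (b 0) := by
          rintro _ ⟨v, rfl⟩
          have hv : x₀ v = b.repr v 0 • x₀ (b 0) := by
            calc x₀ v = x₀ (v - e v) + (x₀ * e) v := by rw [Module.End.mul_apply, map_sub, sub_add_cancel]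
              _ = b.repr v 0 • x₀ (b 0) := by rw [hx₀e, LinearMap.zero_apply, add_zero, hsub, map_smul]
          rw [hv]
          exact Submodule.smul_mem _ _ (Submodule.mem_span_singleton_self _)
        exact (Submodule.finrank_mono hle).trans (finrank_span_singleton_le_one _)
      have hU := Submodule.finrank_add_le_finrank_add_finrank (K ∙ b 0) (LinearMap.range x₀)
      have h1 := finrank_span_singleton_le_one (K := K) (b 0)
      rw [h, finrank_top, hM3] at hU
      omega
  -- §3': `E₋ ⊆ 𝔊`
  have Em_le : Submodule.span K ({(b.coord 1).smulRight (b 0), (b.coord 2).smulRight (b 0)} :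
      Set (Module.End K M)) ≤ 𝔊 := by
    by_contra hnot
    obtain ⟨X₂, hX₂, hy₁⟩ := exists_minus
    obtain ⟨y₀, hy₀def⟩ : ∃ y₀ : Module.End K M, y₀ = (1 - e) * X₂ * e := ⟨_, rfl⟩
    rw [← hy₀def] at hy₁
    have hy₀𝔊 : y₀ ∈ 𝔊 := hy₀def ▸ (components_mem_of_ad_stable 𝔊 he had hX₂).2.1
    have hey₀ : e * y₀ = 0 := by
      rw [hy₀def, show e * ((1 - e) * X₂ * e) = (e * (1 - e)) * X₂ * e by noncomm_ring, idem_mul_one_sub he, zero_mul,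
        zero_mul]
    have hy₀e : y₀ * e = y₀ := by
      rw [hy₀def, show (1 - e) * X₂ * e * e = (1 - e) * X₂ * (e * e) by noncomm_ring, he]
    have hy₀E := mem_Em y₀ hey₀ hy₀e
    have hlt : 𝔊 ⊓ Submodule.span K ({(b.coord 1).smulRight (b 0), (b.coord 2).smulRight (b 0)} :
        Set (Module.End K M)) < Submodule.span K ({(b.coord 1).smulRight (b 0), (b.coord 2).smulRight (b 0)} :
        Set (Module.End K M)) := lt_of_le_of_ne inf_le_right fun h => hnot (h ▸ inf_le_left)
    have hspan : 𝔊 ⊓ Submodule.span K ({(b.coord 1).smulRight (b 0), (b.coord 2).smulRight (b 0)} :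
        Set (Module.End K M)) = K ∙ y₀ := by
      refine (Submodule.eq_of_le_of_finrank_le
        ((Submodule.span_singleton_le_iff_mem _ _).2 (Submodule.mem_inf.2 ⟨hy₀𝔊, hy₀E⟩)) ?_).symm
      have h := Submodule.finrank_lt_finrank_of_lt hlt
      rw [finrank_span_singleton hy₁]
      omega
    have hmult : ∀ Z ∈ 𝔊, e * Z = 0 → Z * e = Z → ∃ t : K, t • y₀ = Z := fun Z hZ h1 h2 =>
      Submodule.mem_span_singleton.1 (hspan ▸ (Submodule.mem_inf.2 ⟨hZ, mem_Em Z h1 h2⟩ :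
        Z ∈ 𝔊 ⊓ Submodule.span K ({(b.coord 1).smulRight (b 0), (b.coord 2).smulRight (b 0)} : Set (Module.End K M))))
    -- the stable line `⟨b₁, b₂⟩ ∩ ker y₀`
    have hstab : ∀ Z ∈ 𝔊, ∀ u ∈ Submodule.span K ({b 1, b 2} : Set M) ⊓ LinearMap.ker y₀,
        Z u ∈ Submodule.span K ({b 1, b 2} : Set M) ⊓ LinearMap.ker y₀ := by
      intro Z hZ u hu
      obtain ⟨huP, huy⟩ := Submodule.mem_inf.1 hu
      rw [LinearMap.mem_ker] at huy
      obtain ⟨-, hZm, hZd⟩ := components_mem_of_ad_stable 𝔊 he had hZ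
      obtain ⟨t, ht⟩ := hmult _ hZm
        (by rw [show e * ((1 - e) * Z * e) = (e * (1 - e)) * Z * e by noncomm_ring, idem_mul_one_sub he, zero_mul,
          zero_mul])
        (by rw [show (1 - e) * Z * e * e = (1 - e) * Z * (e * e) by noncomm_ring, he])
      have hB1 : e * ((e * Z * e + (1 - e) * Z * (1 - e)) * y₀ - y₀ * (e * Z * e + (1 - e) * Z * (1 - e))) = 0 := by
        rw [mul_sub, ← mul_assoc e _ y₀, idem_mul_diag he Z, show e * Z * e * y₀ = e * Z * (e * y₀) by noncomm_ring,
          hey₀, mul_zero, ← mul_assoc e y₀, hey₀, zero_mul, sub_zero]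
      have hB2 : ((e * Z * e + (1 - e) * Z * (1 - e)) * y₀ - y₀ * (e * Z * e + (1 - e) * Z * (1 - e))) * e =
          (e * Z * e + (1 - e) * Z * (1 - e)) * y₀ - y₀ * (e * Z * e + (1 - e) * Z * (1 - e)) := by
        rw [sub_mul, mul_assoc _ y₀ e, hy₀e, mul_assoc y₀ _ e, diag_mul_idem he Z, mul_diag_of_mul_idem_eq hy₀e Z,
          show y₀ * (e * Z * e) = (y₀ * e) * Z * e by noncomm_ring, hy₀e]
      obtain ⟨t', ht'⟩ := hmult _ (hbr _ hZd _ hy₀𝔊) hB1 hB2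
      have hZu : Z u = (e * Z * e + (1 - e) * Z * (1 - e)) u + (e * Z * (1 - e)) u + ((1 - e) * Z * e) u := by
        conv_lhs => rw [decomp_idem e Z]
        rw [LinearMap.add_apply, LinearMap.add_apply]
      have hd : (e * Z * e + (1 - e) * Z * (1 - e)) u = e (Z u) := by
        rw [happ_diag, hPfix u huP, sub_self, map_zero, map_zero, sub_zero, add_zero]
      have hp : (e * Z * (1 - e)) u = 0 := by rw [happ_plus, hPfix u huP, sub_self, map_zero, map_zero]
      have hm : ((1 - e) * Z * e) u = 0 := by rw [← ht, LinearMap.smul_apply, huy, smul_zero]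
      rw [hZu, hp, hm, add_zero, add_zero]
      refine Submodule.mem_inf.2 ⟨by rw [hd]; exact hPmem _, ?_⟩
      rw [LinearMap.mem_ker, ← Module.End.mul_apply,
        show y₀ * (e * Z * e + (1 - e) * Z * (1 - e)) = (e * Z * e + (1 - e) * Z * (1 - e)) * y₀ - t' • y₀ by
          rw [ht']; abel,
        LinearMap.sub_apply, Module.End.mul_apply, huy, map_zero, LinearMap.smul_apply, huy, smul_zero, sub_zero]
    rcases hirr _ hstab with h | h
    · -- a non-zero vector of `⟨b₁, b₂⟩ ∩ ker y₀`
      have hy₀eq := minus_eq X₂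
      rw [← hy₀def] at hy₀eq
      set c := b.repr (X₂ (b 1)) 0
      set d := b.repr (X₂ (b 2)) 0
      have hv : d • b 1 - c • b 2 ∈ Submodule.span K ({b 1, b 2} : Set M) ⊓ LinearMap.ker y₀ := by
        refine Submodule.mem_inf.2 ⟨Submodule.sub_mem _ (Submodule.smul_mem _ _ (Submodule.subset_span (by simp)))
          (Submodule.smul_mem _ _ (Submodule.subset_span (by simp))), ?_⟩
        rw [LinearMap.mem_ker, hy₀eq, LinearMap.add_apply, LinearMap.smul_apply, LinearMap.smul_apply, map_sub, map_sub,
          map_smul, map_smul, map_smul, map_smul, unit_apply_self, unit_apply_ne b 0 h12, unit_apply_ne b 0 h21,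
          unit_apply_self, smul_zero, smul_zero, sub_zero, zero_sub, smul_neg, smul_smul, smul_smul, mul_comm d c,
          add_neg_cancel]
      rw [h, Submodule.mem_bot, sub_eq_zero] at hv
      have hd : d = 0 := by simpa [h12] using congrArg (fun v => b.repr v 1) hv
      have hc : c = 0 := by simpa [h21] using congrArg (fun v => b.repr v 2) hv.symm
      exact hy₁ (by rw [hy₀eq, hc, hd, zero_smul, zero_smul, add_zero])
    · have hb0 : b 0 ∈ Submodule.span K ({b 1, b 2} : Set M) ⊓ LinearMap.ker y₀ := h ▸ Submodule.mem_top
      have h1 := hPfix _ (Submodule.mem_inf.1 hb0).1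
      rw [he0] at h1
      exact b.ne_zero 0 h1.symm
  -- §4: the matrix units in `𝔊` and the conclusion
  have hE10 : (b.coord 0).smulRight (b 1) ∈ 𝔊 := Ep_le (Submodule.subset_span (by simp))
  have hE20 : (b.coord 0).smulRight (b 2) ∈ 𝔊 := Ep_le (Submodule.subset_span (by simp))
  have hE01 : (b.coord 1).smulRight (b 0) ∈ 𝔊 := Em_le (Submodule.subset_span (by simp))
  have hE02 : (b.coord 2).smulRight (b 0) ∈ 𝔊 := Em_le (Submodule.subset_span (by simp))
  have hE11 : (b.coord 1).smulRight (b 1) - (b.coord 0).smulRight (b 0) ∈ 𝔊 := by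
    have h := hbr _ hE10 _ hE01
    rwa [unit_mul_unit_self, unit_mul_unit_self] at h
  have hE22 : (b.coord 2).smulRight (b 2) - (b.coord 0).smulRight (b 0) ∈ 𝔊 := by
    have h := hbr _ hE20 _ hE02
    rwa [unit_mul_unit_self, unit_mul_unit_self] at h
  have hE12 : (b.coord 2).smulRight (b 1) ∈ 𝔊 := by
    have h := hbr _ hE10 _ hE02
    rwa [unit_mul_unit_self, unit_mul_unit_ne b 0 h21, sub_zero] at h
  have hE21 : (b.coord 1).smulRight (b 2) ∈ 𝔊 := by
    have h := hbr _ hE20 _ hE01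
    rwa [unit_mul_unit_self, unit_mul_unit_ne b 0 h12, sub_zero] at h
  have htr : b.repr (Y (b 0)) 0 + b.repr (Y (b 1)) 1 + b.repr (Y (b 2)) 2 = 0 := by
    rw [trace_eq_sum_repr b, Fin.sum_univ_three] at hY
    exact hY
  have hYeq : Y = b.repr (Y (b 0)) 1 • (b.coord 0).smulRight (b 1) + b.repr (Y (b 0)) 2 • (b.coord 0).smulRight (b 2) +
      b.repr (Y (b 1)) 0 • (b.coord 1).smulRight (b 0) + b.repr (Y (b 2)) 0 • (b.coord 2).smulRight (b 0) +
      b.repr (Y (b 1)) 1 • ((b.coord 1).smulRight (b 1) - (b.coord 0).smulRight (b 0)) +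
      b.repr (Y (b 2)) 2 • ((b.coord 2).smulRight (b 2) - (b.coord 0).smulRight (b 0)) +
      b.repr (Y (b 2)) 1 • (b.coord 2).smulRight (b 1) + b.repr (Y (b 1)) 2 • (b.coord 1).smulRight (b 2) := by
    have h00 : b.repr (Y (b 0)) 0 = -b.repr (Y (b 1)) 1 - b.repr (Y (b 2)) 2 := by linear_combination htr
    conv_lhs => rw [eq_sum_units b Y, Fin.sum_univ_three, Fin.sum_univ_three, Fin.sum_univ_three, Fin.sum_univ_three, h00]
    module
  rw [hYeq]
  refine Submodule.add_mem _ (Submodule.add_mem _ (Submodule.add_mem _ (Submodule.add_mem _ (Submodule.add_mem _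
    (Submodule.add_mem _ (Submodule.add_mem _ (Submodule.smul_mem _ _ hE10) (Submodule.smul_mem _ _ hE20))
    (Submodule.smul_mem _ _ hE01)) (Submodule.smul_mem _ _ hE02)) (Submodule.smul_mem _ _ hE11))
    (Submodule.smul_mem _ _ hE22)) (Submodule.smul_mem _ _ hE12)) (Submodule.smul_mem _ _ hE21)

/-! ## §5 The relative form: an invariant `3`-space of a larger module -/

/-- **RELATIVE FORM**: let `𝔊 ⊆ End(M)` be a subspace closed under `YZ − ZY` leaving a `3`-dimensional `W ⊆ M` invariant,
with no `𝔊`-stable subspace of `W` other than `0` and `W`, and containing an element `D` acting on a basis `b` of `W` by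
`D b₀ = β b₀`, `D b₁ = α b₁`, `D b₂ = α b₂` with `α ≠ β` (in the application: the Hodge operator `Θ = ±1` on an
eigenspace `W_σ` of signature `(2,1)` or `(1,2)`). Then every traceless endomorphism of `W` is the restriction of an
element of `𝔊` — `𝔊` acts on `W` through all of `𝔰𝔩(W)`. (The restrictions form an `ad(e)`-stable irreducible
algebra for the idempotent `e = (α − β)⁻¹(D|_W − β)`, and `mem_of_trace_eq_zero_of_irreducible_three` applies.)
[cite: Humphreys1972, §1.2 and §8.1] [cite: MoonenZarhin1999LowDim, §2 (2.3)] -/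
theorem exists_mem_forall_eq_of_trace_eq_zero_three (W : Submodule K M) (bW : Basis (Fin 3) K W)
    (𝔊 : Submodule K (Module.End K M)) (hbr : ∀ Y ∈ 𝔊, ∀ Z ∈ 𝔊, Y * Z - Z * Y ∈ 𝔊)
    (hW : ∀ Z ∈ 𝔊, ∀ w ∈ W, Z w ∈ W)
    (hirr : ∀ U ≤ W, (∀ Z ∈ 𝔊, ∀ u ∈ U, Z u ∈ U) → U = ⊥ ∨ U = W)
    {D : Module.End K M} (hD : D ∈ 𝔊) {α β : K} (hαβ : α ≠ β)
    (hD0 : D (bW 0 : W) = β • (bW 0 : M)) (hD1 : D (bW 1 : W) = α • (bW 1 : M)) (hD2 : D (bW 2 : W) = α • (bW 2 : M))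
    {Y : Module.End K W} (hY : LinearMap.trace K W Y = 0) : ∃ Z ∈ 𝔊, ∀ w : W, (Y w : M) = Z w := by
  classical
  -- the restrictions of `𝔊` to `W`
  let 𝔊W : Submodule K (Module.End K W) :=
    { carrier := {B | ∃ Z ∈ 𝔊, ∀ w : W, (B w : M) = Z w}
      zero_mem' := ⟨0, 𝔊.zero_mem, fun w ↦ by simp⟩
      add_mem' := fun {B₁ B₂} h₁ h₂ ↦ by
        obtain ⟨Z₁, hZ₁, h₁⟩ := h₁
        obtain ⟨Z₂, hZ₂, h₂⟩ := h₂
        exact ⟨Z₁ + Z₂, 𝔊.add_mem hZ₁ hZ₂, fun w ↦ by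
          rw [LinearMap.add_apply, Submodule.coe_add, h₁, h₂, LinearMap.add_apply]⟩
      smul_mem' := fun c {B} h ↦ by
        obtain ⟨Z, hZ, h⟩ := h
        exact ⟨c • Z, 𝔊.smul_mem c hZ, fun w ↦ by
          rw [LinearMap.smul_apply, Submodule.coe_smul, h, LinearMap.smul_apply]⟩ }
  have hmem : ∀ {B : Module.End K W}, B ∈ 𝔊W ↔ ∃ Z ∈ 𝔊, ∀ w : W, (B w : M) = Z w := Iff.rfl
  have hbrW : ∀ B₁ ∈ 𝔊W, ∀ B₂ ∈ 𝔊W, B₁ * B₂ - B₂ * B₁ ∈ 𝔊W := by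
    intro B₁ h₁ B₂ h₂
    obtain ⟨Z₁, hZ₁, h₁⟩ := hmem.1 h₁
    obtain ⟨Z₂, hZ₂, h₂⟩ := hmem.1 h₂
    refine hmem.2 ⟨Z₁ * Z₂ - Z₂ * Z₁, hbr Z₁ hZ₁ Z₂ hZ₂, fun w ↦ ?_⟩
    rw [LinearMap.sub_apply, Submodule.coe_sub, Module.End.mul_apply, Module.End.mul_apply, h₁, h₂, h₂, h₁,
      LinearMap.sub_apply, Module.End.mul_apply, Module.End.mul_apply]
  have hirrW : ∀ U : Submodule K W, (∀ B ∈ 𝔊W, ∀ u ∈ U, B u ∈ U) → U = ⊥ ∨ U = ⊤ := by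
    intro U hU
    have hstab : ∀ Z ∈ 𝔊, ∀ u ∈ U.map W.subtype, Z u ∈ U.map W.subtype := by
      intro Z hZ u hu
      obtain ⟨u', hu', rfl⟩ := hu
      have hB : Z.restrict (hW Z hZ) ∈ 𝔊W := hmem.2 ⟨Z, hZ, fun w ↦ LinearMap.coe_restrict_apply (hW Z hZ) w⟩
      exact ⟨Z.restrict (hW Z hZ) u', hU _ hB u' hu', LinearMap.coe_restrict_apply (hW Z hZ) u'⟩
    rcases hirr (U.map W.subtype) (Submodule.map_subtype_le W U) hstab with h | h
    · left
      have h' : U.map W.subtype = (⊥ : Submodule K W).map W.subtype := by rw [h, Submodule.map_bot]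
      exact Submodule.map_injective_of_injective W.injective_subtype h'
    · right
      have h' : U.map W.subtype = (⊤ : Submodule K W).map W.subtype := by rw [h, Submodule.map_subtype_top]
      exact Submodule.map_injective_of_injective W.injective_subtype h'
  -- the idempotent `e = (α − β)⁻¹ (D|_W − β)`
  have hDW : D.restrict (hW D hD) ∈ 𝔊W := hmem.2 ⟨D, hD, fun w ↦ LinearMap.coe_restrict_apply (hW D hD) w⟩
  have hαβ' : (α - β) ≠ 0 := sub_ne_zero.2 hαβ
  have hDk : ∀ (k : Fin 3) (c : K), D (bW k : W) = c • (bW k : M) → D.restrict (hW D hD) (bW k) = c • bW k :=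
    fun k c h => Subtype.ext (by rw [LinearMap.coe_restrict_apply, h, Submodule.coe_smul])
  have he0 : ((α - β)⁻¹ • (D.restrict (hW D hD) - β • 1)) (bW 0) = 0 := by
    rw [LinearMap.smul_apply, LinearMap.sub_apply, hDk 0 β hD0, LinearMap.smul_apply, Module.End.one_apply, sub_self,
      smul_zero]
  have he1 : ((α - β)⁻¹ • (D.restrict (hW D hD) - β • 1)) (bW 1) = bW 1 := by
    rw [LinearMap.smul_apply, LinearMap.sub_apply, hDk 1 α hD1, LinearMap.smul_apply, Module.End.one_apply, ← sub_smul,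
      smul_smul, inv_mul_cancel₀ hαβ', one_smul]
  have he2 : ((α - β)⁻¹ • (D.restrict (hW D hD) - β • 1)) (bW 2) = bW 2 := by
    rw [LinearMap.smul_apply, LinearMap.sub_apply, hDk 2 α hD2, LinearMap.smul_apply, Module.End.one_apply, ← sub_smul,
      smul_smul, inv_mul_cancel₀ hαβ', one_smul]
  have had : ∀ B ∈ 𝔊W, ((α - β)⁻¹ • (D.restrict (hW D hD) - β • 1)) * B -
      B * ((α - β)⁻¹ • (D.restrict (hW D hD) - β • 1)) ∈ 𝔊W := by
    intro B hB
    have h : ((α - β)⁻¹ • (D.restrict (hW D hD) - β • 1)) * B - B * ((α - β)⁻¹ • (D.restrict (hW D hD) - β • 1)) =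
        (α - β)⁻¹ • (D.restrict (hW D hD) * B - B * D.restrict (hW D hD)) := by
      refine LinearMap.ext fun w => ?_
      simp only [LinearMap.sub_apply, LinearMap.smul_apply, Module.End.mul_apply, Module.End.one_apply, map_sub,
        map_smul]
      module
    rw [h]
    exact 𝔊W.smul_mem _ (hbrW _ hDW _ hB)
  exact hmem.1 (mem_of_trace_eq_zero_of_irreducible_three bW 𝔊W hbrW hirrW he0 he1 he2 had hY)

end Three

end Literature.Algebra.Lie
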